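import Mathlib
import HarnessLib
import Literature.Analysis.FluidPDE.SwirlMaximumPrinciple
import Literature.Analysis.FluidPDE.NSWave0

/-!
# No swirling profile for an axisymmetric frozen-eddy collapse (crux stmt-NavierStokesRegularity-1430)

Route AdiabaticEddy, crux `FrozenEddyCollapse` (stmt-1430) / kill `NoFrozenEddyCollapse` (stmt-1431).
Ideator 2's barrier note BN2 (`Cruxes/FrozenEddyCollapse/NegativeNotes-ideator2.md`, typed there as
`Ideator2.NoAxisymmetricFrozenEddyCollapse`), made a theorem under the one hypothesis the tree's swirl
maximum principle needs (velocity bounded on every closed sub-slab `[0, T'] × ℝ³`, `T' < T`):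

if a classical solution on `[0, T)` from a rapidly decaying datum is AXISYMMETRIC (about the `x₂`-axis)
and its renormalisation `(T - t)^α • u t (ξ t + ℓ√(ν(T - t)) • y)` with `α > 1/2` and an ON-AXIS centre
path `ξ` converges (pointwise in `y` suffices) to a profile `U`, then `U` is swirl-free (`HasNoSwirl U`).

Mechanism (KNSS 2009 (1.9) / Lei–Zhang 2017 (1.4), in tree as `abs_swirl_le_of_classical`): the swirl
`Γ = x₀u₁ − x₁u₀` obeys `|Γ(t, x)| ≤ sup|Γ₀| =: M`, while along the renormalisation
`(T - t)^α Γ(t, ξ t + L y) = L · (y₀ F₁ − y₁ F₀)(t)` with `L = ℓ√(ν(T - t))` and `F t → U y`; hence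
`|y₀ F₁ − y₁ F₀| ≤ M (T - t)^α / L ∝ (T - t)^{α − 1/2} → 0`, i.e. `swirl U y = 0`: the eddy's
circulation scale `A·L = (T - t)^{1/2 − α} ℓ√ν → ∞` is exactly what the maximum principle forbids.

* `tendsto_rpow_sub_half_nhdsLT` — `(T - t)^{α − 1/2} → 0` as `t ↑ T` (`α > 1/2`).
* `exists_abs_swirl_le_of_hasRapidSpatialDecay` — a rapidly decaying datum has bounded swirl.
* `abs_swirl_le_of_classical_Ico` — the maximum principle on the half-open lifespan `[0, T)`.
* `swirl_profile_eq_zero_of_axisymmetric` — the pointwise statement; `hasNoSwirl_profile_of_axisymmetric`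
  — BN2 in the crux's vocabulary (locally uniform convergence, `α ∈ (1/2, 3/4)`).
-/

noncomputable section

-- the summit-side namespace repeats a component by design (D-0017)
set_option linter.dupNamespace false

namespace Summit.NavierStokesRegularity.NavierStokesRegularity.Theorems

open Filter Topology Set
open Literature.Analysis.FluidPDE

local notation "ℝ³" => EuclideanSpace ℝ (Fin 3)

/-- `(T - t)^{q} → 0` as `t ↑ T` for `q > 0` (continuity of `s ↦ s^q` at `0`, `0^q = 0`). [folklore] -/
theorem tendsto_rpow_nhdsLT_zero {T q : ℝ} (hq : 0 < q) :
    Tendsto (fun t : ℝ => (T - t) ^ q) (𝓝[<] T) (𝓝 0) := by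
  have hsub : Tendsto (fun t : ℝ => T - t) (𝓝[<] T) (𝓝 0) := by
    have hc : Tendsto (fun t : ℝ => T - t) (𝓝 T) (𝓝 (T - T)) :=
      (continuous_const.sub continuous_id).tendsto T
    rw [sub_self] at hc
    exact hc.mono_left nhdsWithin_le_nhds
  have hc0 : ContinuousAt (fun s : ℝ => s ^ q) 0 := Real.continuousAt_rpow_const 0 q (Or.inr hq.le)
  have h0 : Tendsto (fun t : ℝ => (T - t) ^ q) (𝓝[<] T) (𝓝 ((0 : ℝ) ^ q)) := hc0.tendsto.comp hsub
  rwa [Real.zero_rpow hq.ne'] at h0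

/-- **A rapidly decaying datum has bounded swirl**: Fefferman's decay (4) with `n = 0`, `K = 1`
gives `(1 + ‖x‖)‖u₀ x‖ ≤ C`, and `|Γ₀(x)| ≤ 2‖x‖‖u₀ x‖ ≤ 2C` (`abs_swirl_le_norm_mul`). [folklore] -/
theorem exists_abs_swirl_le_of_hasRapidSpatialDecay {u₀ : ℝ³ → ℝ³} (h : HasRapidSpatialDecay u₀) :
    ∃ M : ℝ, ∀ x, |swirl u₀ x| ≤ M := by
  obtain ⟨C, hC⟩ := h 0 1
  refine ⟨2 * C, fun x => ?_⟩
  have hx : (1 + ‖x‖) * ‖u₀ x‖ ≤ C := by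
    simpa [norm_iteratedFDeriv_zero] using hC x
  calc |swirl u₀ x| ≤ 2 * ‖x‖ * ‖u₀ x‖ := abs_swirl_le_norm_mul u₀ x
    _ ≤ 2 * ((1 + ‖x‖) * ‖u₀ x‖) := by
        nlinarith [norm_nonneg x, norm_nonneg (u₀ x)]
    _ ≤ 2 * C := by linarith

/-- **Swirl maximum principle on the half-open lifespan.** For a classical solution (`ν > 0`) on
`[0, T)` with axisymmetric slices, velocity bounded on every closed sub-slab `[0, T']`, `T' < T`, and
`|Γ₀| ≤ M`, one has `|Γ(t, x)| ≤ M` for all `t ∈ [0, T)` (apply `abs_swirl_le_of_classical` on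
`[0, (t + T)/2]`; Lei–Zhang 2017, (1.4); KNSS 2009, (1.9)). [cite: LeiZhang2017, §1 (1.4) (arXiv p. 3)] -/
theorem abs_swirl_le_of_classical_Ico {T ν M : ℝ} {u : ℝ → ℝ³ → ℝ³} {p : ℝ → ℝ³ → ℝ}
    (hν : 0 < ν) (hcl : IsClassicalNSSolutionOn (Ico 0 T) ν 0 u p)
    (haxi : ∀ t ∈ Ico 0 T, IsAxisymmetric (u t))
    (hbdd : ∀ T' ∈ Ioo 0 T, ∃ V : ℝ, ∀ t ∈ Icc 0 T', ∀ x, ‖u t x‖ ≤ V)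
    (hM : ∀ x, |swirl (u 0) x| ≤ M) :
    ∀ t ∈ Ico 0 T, ∀ x, |swirl (u t) x| ≤ M := by
  intro t ht x
  set T' : ℝ := (t + T) / 2 with hT'
  have hT'pos : 0 < T' := by rw [hT']; linarith [ht.1, ht.2]
  have hT'T : T' < T := by rw [hT']; linarith [ht.2]
  have htT' : t ≤ T' := by rw [hT']; linarith [ht.2]
  have hsub : Icc 0 T' ⊆ Ico 0 T := fun s hs => ⟨hs.1, hs.2.trans_lt hT'T⟩
  have hcl' : IsClassicalNSSolutionOn (Icc 0 T') ν 0 u p := hcl.mono hsub (uniqueDiffOn_Icc hT'pos)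
  obtain ⟨V, hV⟩ := hbdd T' ⟨hT'pos, hT'T⟩
  exact abs_swirl_le_of_classical hν hT'pos hcl' (fun s hs => haxi s (hsub hs)) hV hM t ⟨ht.1, htT'⟩ x

/-- **The frozen profile of an axisymmetric collapse has no swirl at `y` (pointwise form).**
Classical solution on `[0, T)` (`ν > 0`, `T > 0`), axisymmetric slices, velocity bounded on closed
sub-slabs, bounded initial swirl; if `(T - t)^α • u t (ξ t + (ℓ√(ν(T - t))) • y) → v` as `t ↑ T` with
`α > 1/2`, `ℓ > 0` and `ξ t` on the axis, then `y₀ v₁ − y₁ v₀ = 0`. [folklore] -/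
theorem swirl_profile_eq_zero_of_axisymmetric {T ν α ℓ : ℝ} {u : ℝ → ℝ³ → ℝ³} {p : ℝ → ℝ³ → ℝ}
    (hν : 0 < ν) (hT : 0 < T) (hcl : IsClassicalNSSolutionOn (Ico 0 T) ν 0 u p)
    (haxi : ∀ t ∈ Ico 0 T, IsAxisymmetric (u t))
    (hbdd : ∀ T' ∈ Ioo 0 T, ∃ V : ℝ, ∀ t ∈ Icc 0 T', ∀ x, ‖u t x‖ ≤ V)
    (hM : ∃ M : ℝ, ∀ x, |swirl (u 0) x| ≤ M) (hα : 1 / 2 < α) (hℓ : 0 < ℓ)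
    {ξ : ℝ → ℝ³} (hξ : ∀ t, ξ t 0 = 0 ∧ ξ t 1 = 0) {y v : ℝ³}
    (hconv : Tendsto (fun t => ((T - t) ^ α) • u t (ξ t + (ℓ * Real.sqrt (ν * (T - t))) • y))
      (𝓝[<] T) (𝓝 v)) :
    y 0 * v 1 - y 1 * v 0 = 0 := by
  obtain ⟨M, hM⟩ := hM
  have hΓ := abs_swirl_le_of_classical_Ico hν hcl haxi hbdd hM
  -- notation
  set L : ℝ → ℝ := fun t => ℓ * Real.sqrt (ν * (T - t)) with hL
  set x : ℝ → ℝ³ := fun t => ξ t + (L t) • y with hx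
  set F : ℝ → ℝ³ := fun t => ((T - t) ^ α) • u t (x t) with hF
  set G : ℝ → ℝ := fun t => y 0 * F t 1 - y 1 * F t 0 with hG
  -- `G t → y₀ v₁ − y₁ v₀`
  have hconvF : Tendsto F (𝓝[<] T) (𝓝 v) := hconv
  have hG1 : Tendsto G (𝓝[<] T) (𝓝 (y 0 * v 1 - y 1 * v 0)) := by
    have h1 : Tendsto (fun t => F t 1) (𝓝[<] T) (𝓝 (v 1)) :=
      ((PiLp.continuous_apply 2 _ 1).tendsto v).comp hconvF
    have h0 : Tendsto (fun t => F t 0) (𝓝[<] T) (𝓝 (v 0)) :=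
      ((PiLp.continuous_apply 2 _ 0).tendsto v).comp hconvF
    exact (h1.const_mul (y 0)).sub (h0.const_mul (y 1))
  -- the swirl identity along the renormalisation: `(T - t)^α Γ(t, x t) = L t * G t`
  have hswirl : ∀ t, (T - t) ^ α * swirl (u t) (x t) = L t * G t := by
    intro t
    have hx0 : x t 0 = L t * y 0 := by
      simp only [hx, PiLp.add_apply, PiLp.smul_apply, smul_eq_mul, (hξ t).1, zero_add]
    have hx1 : x t 1 = L t * y 1 := by
      simp only [hx, PiLp.add_apply, PiLp.smul_apply, smul_eq_mul, (hξ t).2, zero_add]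
    have hF0 : F t 0 = (T - t) ^ α * u t (x t) 0 := by
      simp only [hF, PiLp.smul_apply, smul_eq_mul]
    have hF1 : F t 1 = (T - t) ^ α * u t (x t) 1 := by
      simp only [hF, PiLp.smul_apply, smul_eq_mul]
    simp only [swirl, hG, hx0, hx1, hF0, hF1]
    ring
  -- `G t → 0`: `|G t| ≤ (M / (ℓ √ν)) (T - t)^{α - 1/2}` for `t ∈ [0, T)`
  have hG0 : Tendsto G (𝓝[<] T) (𝓝 0) := by
    have hbound : ∀ᶠ t in 𝓝[<] T, ‖G t‖ ≤ M / (ℓ * Real.sqrt ν) * (T - t) ^ (α - 1 / 2) := by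
      filter_upwards [Ico_mem_nhdsLT hT] with t ht
      have hTt : 0 < T - t := sub_pos.2 ht.2
      have hsqν : 0 < Real.sqrt ν := Real.sqrt_pos.2 hν
      have hLt : L t = ℓ * Real.sqrt ν * (T - t) ^ (1 / 2 : ℝ) := by
        simp only [hL]
        rw [Real.sqrt_mul hν.le, Real.sqrt_eq_rpow (T - t)]
        ring
      have hLpos : 0 < L t := by
        rw [hLt]; exact mul_pos (mul_pos hℓ hsqν) (Real.rpow_pos_of_pos hTt _)
      have h1 : |L t * G t| ≤ (T - t) ^ α * M := by
        rw [← hswirl t, abs_mul, abs_of_nonneg (Real.rpow_nonneg hTt.le α)]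
        exact mul_le_mul_of_nonneg_left (hΓ t ht (x t)) (Real.rpow_nonneg hTt.le α)
      rw [abs_mul, abs_of_pos hLpos] at h1
      have h2 : |G t| ≤ (T - t) ^ α * M / L t := by
        rw [le_div_iff₀ hLpos]; linarith
      have h3 : (T - t) ^ α * M / L t = M / (ℓ * Real.sqrt ν) * (T - t) ^ (α - 1 / 2) := by
        rw [hLt, Real.rpow_sub hTt]
        field_simp
      rw [Real.norm_eq_abs]
      linarith [h2, h3.le, h3.ge]
    have hlim : Tendsto (fun t => M / (ℓ * Real.sqrt ν) * (T - t) ^ (α - 1 / 2)) (𝓝[<] T) (𝓝 0) := by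
      simpa using (tendsto_rpow_nhdsLT_zero (T := T) (by linarith : 0 < α - 1 / 2)).const_mul
        (M / (ℓ * Real.sqrt ν))
    exact squeeze_zero_norm' hbound hlim
  exact tendsto_nhds_unique hG1 hG0

/-- **No swirling profile for an axisymmetric frozen-eddy collapse (BN2 of the crux notes, with the
boundedness hypothesis the maximum principle needs).** Let `(u, p)` be a classical solution of
unforced Navier–Stokes (`ν > 0`) on `ℝ³ × [0, T)` from a rapidly decaying datum, axisymmetric about the
`x₂`-axis, with velocity bounded on every `[0, T'] × ℝ³`, `T' < T`.  If for some `α ∈ (1/2, 3/4)`,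
`ℓ > 0` and an on-axis centre path `ξ` the renormalised field
`(T - t)^α • u t (ξ t + ℓ√(ν(T - t)) • y)` converges locally uniformly to `U` as `t ↑ T` (the clause of
`AdiabaticEddy.FrozenEddyCollapse` / `NoFrozenEddyCollapse`), then `HasNoSwirl U`: a swirling frozen
eddy needs a circulation scale `A·L → ∞`, forbidden by the swirl maximum principle
(KNSS 2009 (1.9); Lei–Zhang 2017 (1.4)). [folklore] -/
theorem hasNoSwirl_profile_of_axisymmetric {T ν : ℝ} (hν : 0 < ν) (hT : 0 < T)
    {u : ℝ → ℝ³ → ℝ³} {p : ℝ → ℝ³ → ℝ} (hcl : IsClassicalNSSolutionOn (Ico 0 T) ν 0 u p)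
    (hdec : HasRapidSpatialDecay (u 0)) (haxi : ∀ t ∈ Ico 0 T, IsAxisymmetric (u t))
    (hbdd : ∀ T' ∈ Ioo 0 T, ∃ V : ℝ, ∀ t ∈ Icc 0 T', ∀ x, ‖u t x‖ ≤ V)
    {U : ℝ³ → ℝ³} {α : ℝ} (hα : α ∈ Ioo (1 / 2 : ℝ) (3 / 4)) {ℓ : ℝ} (hℓ : 0 < ℓ)
    {ξ : ℝ → ℝ³} (hξ : ∀ t, ξ t 0 = 0 ∧ ξ t 1 = 0)
    (hconv : TendstoLocallyUniformly
      (fun (t : ℝ) (y : ℝ³) => ((T - t) ^ α) • u t (ξ t + (ℓ * Real.sqrt (ν * (T - t))) • y)) U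
      (𝓝[<] T)) :
    HasNoSwirl U := by
  intro y
  exact swirl_profile_eq_zero_of_axisymmetric hν hT hcl haxi hbdd
    (exists_abs_swirl_le_of_hasRapidSpatialDecay hdec) hα.1 hℓ hξ
    (hconv.tendstoLocallyUniformlyOn.tendsto_at (mem_univ y))

/-- A point of the axis is fixed by every rotation `R_θ`. [folklore] -/
theorem rotZ_eq_self_of_onAxis {ξ : ℝ³} (h0 : ξ 0 = 0) (h1 : ξ 1 = 0) (θ : ℝ) : rotZ θ ξ = ξ := by
  ext i
  fin_cases i
  · simp [rotZ, h0, h1]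
  · simp [rotZ, h0, h1]
  · simp [rotZ]

/-- **The frozen profile of an axisymmetric collapse is axisymmetric.** If the slices `u t`,
`t ∈ [0, T)`, are axisymmetric and the centre path lies on the axis, every pointwise limit `U` of the
renormalisation `(T - t)^α • u t (ξ t + L(t) • y)` as `t ↑ T` is axisymmetric: the renormalised
slices are axisymmetric (`R_θ` is linear, fixes `ξ t`, and commutes with `u t`) and axisymmetry is
closed under pointwise limits (`R_θ` continuous). No equation is used. [folklore] -/
theorem isAxisymmetric_profile_of_axisymmetric {T α : ℝ} (hT : 0 < T) {u : ℝ → ℝ³ → ℝ³}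
    (haxi : ∀ t ∈ Ico 0 T, IsAxisymmetric (u t)) {L : ℝ → ℝ} {ξ : ℝ → ℝ³}
    (hξ : ∀ t, ξ t 0 = 0 ∧ ξ t 1 = 0) {U : ℝ³ → ℝ³}
    (hconv : ∀ y, Tendsto (fun t => ((T - t) ^ α) • u t (ξ t + (L t) • y)) (𝓝[<] T) (𝓝 (U y))) :
    IsAxisymmetric U := by
  intro θ y
  have h1 : Tendsto (fun t => ((T - t) ^ α) • u t (ξ t + (L t) • rotZ θ y)) (𝓝[<] T)
      (𝓝 (U (rotZ θ y))) := hconv (rotZ θ y)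
  have h2 : Tendsto (fun t => rotZ θ (((T - t) ^ α) • u t (ξ t + (L t) • y))) (𝓝[<] T)
      (𝓝 (rotZ θ (U y))) :=
    ((rotZL θ).continuous.tendsto (U y)).comp (hconv y)
  have heq : ∀ᶠ t in 𝓝[<] T, rotZ θ (((T - t) ^ α) • u t (ξ t + (L t) • y)) =
      ((T - t) ^ α) • u t (ξ t + (L t) • rotZ θ y) := by
    filter_upwards [Ico_mem_nhdsLT hT] with t ht
    have hx : rotZ θ (ξ t + (L t) • y) = ξ t + (L t) • rotZ θ y := by
      rw [← rotZL_apply, map_add, map_smul, rotZL_apply, rotZL_apply,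
        rotZ_eq_self_of_onAxis (hξ t).1 (hξ t).2]
    rw [← rotZL_apply, map_smul, rotZL_apply, ← haxi t ht, hx]
  exact tendsto_nhds_unique h1 (h2.congr' heq)

/-- **Axisymmetric frozen-eddy collapse: the profile is axisymmetric AND swirl-free.** Packaging of
`isAxisymmetric_profile_of_axisymmetric` and `hasNoSwirl_profile_of_axisymmetric` in the vocabulary of
`AdiabaticEddy.NoFrozenEddyCollapse` restricted to axisymmetric solutions with on-axis centre (plus the
sub-slab boundedness the maximum principle needs). What remains of the axisymmetric case of the kill
crux stmt-NavierStokesRegularity-1431 is therefore the steady statement "a smooth compactly supported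
axisymmetric swirl-free steady Euler flow vanishes" (Jiu–Xin; not in the tree). [folklore] -/
theorem axisymmetric_frozenEddy_profile {T ν : ℝ} (hν : 0 < ν) (hT : 0 < T)
    {u : ℝ → ℝ³ → ℝ³} {p : ℝ → ℝ³ → ℝ} (hcl : IsClassicalNSSolutionOn (Ico 0 T) ν 0 u p)
    (hdec : HasRapidSpatialDecay (u 0)) (haxi : ∀ t ∈ Ico 0 T, IsAxisymmetric (u t))
    (hbdd : ∀ T' ∈ Ioo 0 T, ∃ V : ℝ, ∀ t ∈ Icc 0 T', ∀ x, ‖u t x‖ ≤ V)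
    {U : ℝ³ → ℝ³} {α : ℝ} (hα : α ∈ Ioo (1 / 2 : ℝ) (3 / 4)) {ℓ : ℝ} (hℓ : 0 < ℓ)
    {ξ : ℝ → ℝ³} (hξ : ∀ t, ξ t 0 = 0 ∧ ξ t 1 = 0)
    (hconv : TendstoLocallyUniformly
      (fun (t : ℝ) (y : ℝ³) => ((T - t) ^ α) • u t (ξ t + (ℓ * Real.sqrt (ν * (T - t))) • y)) U
      (𝓝[<] T)) :
    IsAxisymmetric U ∧ HasNoSwirl U :=
  ⟨isAxisymmetric_profile_of_axisymmetric hT haxi hξ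
      (fun y => hconv.tendstoLocallyUniformlyOn.tendsto_at (mem_univ y)),
    hasNoSwirl_profile_of_axisymmetric hν hT hcl hdec haxi hbdd hα hℓ hξ hconv⟩

end Summit.NavierStokesRegularity.NavierStokesRegularity.Theorems

end
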